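import Mathlib
import HarnessLib
import Summits.NavierStokesRegularity.NavierStokesRegularity.Theorems.PoloidalWindowDoorPoloidalWindowRigiditySparseEnergyWindow
import Summits.NavierStokesRegularity.NavierStokesRegularity.Theorems.PoloidalWindowDoorPoloidalWindowRigiditySparseEnergyPowerWeights

/-!
# Route `PoloidalWindowDoor`, crux `PoloidalWindowRigidity` (stmt-19708), line `sparse_energy` (cstrat g11) —
# stub S1 `stub_scaledEnergy`, near-apex bootstrap: THE ROUND — integrating an envelope flux majorant over the window `(−R², t₀)`

Seat ns-poloidal-K2-p2 g9 (successor of the interim LEAD-of-record on 19708; file `--supports`).  With `…SparseEnergyEnvFlux.abs_flux_le_envelope` the slice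
flux under the power envelope `Φ_γ = Kρ(ρ²/(−t))^γ` is `≤ K·P·(α₁/R + α₂·C/√(−t)) + α₃·K·P·√(K·P)/R`, `P = (R²/(−t))^γ` (`α₁ = l₂C_Δ`, `α₂ = l₂C_∇ + 2C_∇κ₁√(l₈l₂)`,
`α₃ = 2C_∇κ₂c_f√(8V₁l₂)`).  This file (i) rewrites that majorant as a sum of three pure powers of `−t` (`flux_majorant_rpow`), and (ii) integrates it over
`(−R², t₀)` with `…PowerWeights.integral_neg_rpow` and feeds the round interface `…SparseEnergyWindow.cutoffEnergy_le_far_add_fluxBound`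
(`energy_round`): for `γ ∉ {1, 1/2, 2/3}`,
`E_ψ(t₀) + 2∫∫|Dv|²_Fψ ≤ (A + B)·R + Σ_{b ∈ {γ, γ+½, 3γ/2}} c_b · ((R²)^{1−b} − (−t₀)^{1−b})/(1−b)` with explicit `c_b`
(`c_γ = Kα₁R^{2γ−1}`, `c_{γ+½} = Kα₂CR^{2γ}`, `c_{3γ/2} = α₃K√K R^{3γ−1}`).  The three bootstrap rounds (γ: 17/16 → 5/8 → 1/8 → 0) are instances.

WHAT THIS IS NOT: not a claim about Navier–Stokes, not S1 — the round of its near-apex half with the flux majorant as a HYPOTHESIS on the window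
(bears_on LADDER-NS N0 via crux 19708, line sparse_energy, stub S1). [folklore]
-/

noncomputable section

-- the summit and its single sub-problem share the name (CONVENTIONS §1), as in every Theorems file
set_option linter.dupNamespace false

namespace Summit.NavierStokesRegularity.NavierStokesRegularity.Theorems.PoloidalWindowDoorPoloidalWindowRigiditySparseEnergyRound

open MeasureTheory Set Function Filter Topology Metric intervalIntegral
open scoped RealInnerProductSpace InnerProductSpace Laplacian ENNReal
open Literature.Analysis Literature.Analysis.FluidPDE
open Summit.NavierStokesRegularity.NavierStokesRegularity.Theorems.PoloidalWindowDoorPoloidalWindowRigiditySparseEnergyWindow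
open Summit.NavierStokesRegularity.NavierStokesRegularity.Theorems.PoloidalWindowDoorPoloidalWindowRigiditySparseEnergyPowerWeights

/-! ### The envelope flux majorant as three powers of `−t` -/

/-- `(R²/τ)^γ = R^{2γ} · τ^{−γ}` for `R, τ > 0`. [folklore] -/
theorem envelopeP_eq {R τ γ : ℝ} (hR : 0 < R) (hτ : 0 < τ) : (R ^ 2 / τ) ^ γ = R ^ (2 * γ) * τ ^ (-γ) := by
  rw [Real.div_rpow (sq_nonneg R) hτ.le, Real.rpow_neg hτ.le, div_eq_mul_inv,
    show (R ^ 2 : ℝ) ^ γ = R ^ (2 * γ) by rw [← Real.rpow_natCast R 2, ← Real.rpow_mul hR.le]; norm_num]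

/-- `√((R²/τ)^γ) = R^{γ} · τ^{−γ/2}` for `R, τ > 0`. [folklore] -/
theorem sqrt_envelopeP_eq {R τ γ : ℝ} (hR : 0 < R) (hτ : 0 < τ) : Real.sqrt ((R ^ 2 / τ) ^ γ) = R ^ γ * τ ^ (-(γ / 2)) := by
  rw [Real.sqrt_eq_rpow, ← Real.rpow_mul (div_nonneg (sq_nonneg R) hτ.le), envelopeP_eq hR hτ]
  congr 1 <;> ring_nf

/-- **The envelope flux majorant as three powers of `−t`** (`t < 0`, `R > 0`, `K ≥ 0`):
`K·P·(α₁/R + α₂·C/√(−t)) + α₃·K·P·√(K·P)/R = (Kα₁R^{2γ−1})(−t)^{−γ} + (Kα₂CR^{2γ})(−t)^{−(γ+½)} + (α₃K√K R^{3γ−1})(−t)^{−(3γ/2)}`,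
`P = (R²/(−t))^γ`. [folklore] -/
theorem flux_majorant_rpow {K α₁ α₂ α₃ C γ R t : ℝ} (hK : 0 ≤ K) (hR : 0 < R) (ht : t < 0) :
    K * (R ^ 2 / (-t)) ^ γ * (α₁ / R + α₂ * (C / Real.sqrt (-t))) + α₃ * K * (R ^ 2 / (-t)) ^ γ * Real.sqrt (K * (R ^ 2 / (-t)) ^ γ) / R =
      K * α₁ * R ^ (2 * γ - 1) * (-t) ^ (-γ) + K * α₂ * C * R ^ (2 * γ) * (-t) ^ (-(γ + 1 / 2)) +
        α₃ * K * Real.sqrt K * R ^ (3 * γ - 1) * (-t) ^ (-(3 * γ / 2)) := by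
  have hτ : 0 < -t := neg_pos.2 ht
  have hP := envelopeP_eq (γ := γ) hR hτ
  have hsP : Real.sqrt (K * (R ^ 2 / (-t)) ^ γ) = Real.sqrt K * (R ^ γ * (-t) ^ (-(γ / 2))) := by
    rw [Real.sqrt_mul hK, sqrt_envelopeP_eq hR hτ]
  have hsq : (Real.sqrt (-t))⁻¹ = (-t) ^ (-(1 / 2 : ℝ)) := by
    rw [Real.sqrt_eq_rpow, ← Real.rpow_neg hτ.le]
  rw [hsP, hP, div_eq_mul_inv C, hsq]
  -- collect powers of `R` and of `−t`
  have hR1 : R ^ (2 * γ) / R = R ^ (2 * γ - 1) := by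
    rw [Real.rpow_sub hR, Real.rpow_one]
  have hR2 : R ^ (2 * γ) * R ^ γ / R = R ^ (3 * γ - 1) := by
    rw [← Real.rpow_add hR, Real.rpow_sub hR, Real.rpow_one]; ring_nf
  have hT1 : (-t) ^ (-γ) * (-t) ^ (-(1 / 2 : ℝ)) = (-t) ^ (-(γ + 1 / 2)) := by
    rw [← Real.rpow_add hτ]; ring_nf
  have hT2 : (-t) ^ (-γ) * (-t) ^ (-(γ / 2)) = (-t) ^ (-(3 * γ / 2)) := by
    rw [← Real.rpow_add hτ]; ring_nf
  calc K * (R ^ (2 * γ) * (-t) ^ (-γ)) * (α₁ / R + α₂ * (C * (-t) ^ (-(1 / 2 : ℝ)))) +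
        α₃ * K * (R ^ (2 * γ) * (-t) ^ (-γ)) * (Real.sqrt K * (R ^ γ * (-t) ^ (-(γ / 2)))) / R
      = K * α₁ * (R ^ (2 * γ) / R) * (-t) ^ (-γ) + K * α₂ * C * R ^ (2 * γ) * ((-t) ^ (-γ) * (-t) ^ (-(1 / 2 : ℝ))) +
          α₃ * K * Real.sqrt K * (R ^ (2 * γ) * R ^ γ / R) * ((-t) ^ (-γ) * (-t) ^ (-(γ / 2))) := by ring
    _ = _ := by rw [hR1, hR2, hT1, hT2]

/-! ### The round -/

/-- Continuity of `t ↦ (−t)^{−b}` on `[s, t₀]`, `t₀ < 0`. [folklore] -/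
theorem continuousOn_neg_rpow (b : ℝ) {s t₀ : ℝ} (hst : s ≤ t₀) (ht₀ : t₀ < 0) :
    ContinuousOn (fun t : ℝ => (-t) ^ (-b)) (uIcc s t₀) := by
  rw [uIcc_of_le hst]
  exact fun t ht => ((continuous_neg.continuousAt).rpow_const (Or.inl (neg_pos.2 (lt_of_le_of_lt ht.2 ht₀)).ne')).continuousWithinAt

variable {Cc : ℝ} {v : ℝ → EuclideanSpace ℝ (Fin 3) → EuclideanSpace ℝ (Fin 3)}

/-- **THE ROUND.**  For a profile of the class, a window pressure `q` on `(T,0)` with `T < −R²`, a time `t₀ ∈ (−R², 0)` and an exponent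
`γ ∉ {1, ½, ⅔}`: if on `(−R², t₀]` the slice flux against `cutoff R (a − ·)` is bounded by the envelope majorant
`K·P_t·(α₁/R + α₂·C/√(−t)) + α₃·K·P_t·√(K·P_t)/R`, `P_t = (R²/(−t))^γ`, then
`E_ψ(t₀) + 2∫_{−R²}^{t₀}∫|Dv|²_Fψ ≤ A·R²/√(R²) + B·R³/R² + Σ_b c_b·((R²)^{1−b} − (−t₀)^{1−b})/(1−b)`, `b ∈ {γ, γ+½, 3γ/2}`
(`A, B` the far-half constants of `…FarField.cutoffEnergy_dissipation_le`; note `A R²/√(R²) + B R³/R² = (A+B)R`). [folklore] -/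
theorem energy_round (hrate : HasTypeITimeDecay Cc v)
    (hcont : ContinuousOn (uncurry v) (Iio (0 : ℝ) ×ˢ univ))
    (hmild : ∀ s t : ℝ, s < t → t < 0 → ∀ x,
      v t x = UnboundedOperators.heatExtension (v s) (t - s) x - oseenDuhamel 1 s v v t x)
    (hdiv : ∀ t < 0, VectorCalculus.IsDivFree (v t)) :
    ∃ A B : ℝ, 0 ≤ A ∧ 0 ≤ B ∧ ∀ (T : ℝ) (q : ℝ → EuclideanSpace ℝ (Fin 3) → ℝ), IsClassicalNSSolutionOn (Ioo T 0) 1 0 v q →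
      ∀ (a : EuclideanSpace ℝ (Fin 3)) (R : ℝ), 0 < R → T < -R ^ 2 → ∀ t₀ : ℝ, -R ^ 2 < t₀ → t₀ < 0 →
      ∀ (K α₁ α₂ α₃ C γ : ℝ), 0 ≤ K → γ ≠ 1 → γ ≠ 1 / 2 → γ ≠ 2 / 3 →
        (∀ t ∈ Ioc (-R ^ 2) t₀,
          |∫ x, ((Δ (fun x => cutoff R (a - x))) x * ‖v t x‖ ^ 2 + fderiv ℝ (fun x => cutoff R (a - x)) x (v t x) * ‖v t x‖ ^ 2 +
            2 * (q t x * fderiv ℝ (fun x => cutoff R (a - x)) x (v t x)))| ≤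
            K * (R ^ 2 / (-t)) ^ γ * (α₁ / R + α₂ * (C / Real.sqrt (-t))) +
              α₃ * K * (R ^ 2 / (-t)) ^ γ * Real.sqrt (K * (R ^ 2 / (-t)) ^ γ) / R) →
        (∫ x, cutoff R (a - x) * ‖v t₀ x‖ ^ 2) + 2 * ∫ t in (-R ^ 2)..t₀, ∫ x, frobeniusNormSq (fderiv ℝ (v t) x) * cutoff R (a - x) ≤
          A * R ^ 2 / Real.sqrt (R ^ 2) + B * R ^ 3 / R ^ 2 +
            (K * α₁ * R ^ (2 * γ - 1) * (((R ^ 2) ^ (1 - γ) - (-t₀) ^ (1 - γ)) / (1 - γ)) +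
              K * α₂ * C * R ^ (2 * γ) * (((R ^ 2) ^ (1 - (γ + 1 / 2)) - (-t₀) ^ (1 - (γ + 1 / 2))) / (1 - (γ + 1 / 2))) +
              α₃ * K * Real.sqrt K * R ^ (3 * γ - 1) * (((R ^ 2) ^ (1 - 3 * γ / 2) - (-t₀) ^ (1 - 3 * γ / 2)) / (1 - 3 * γ / 2))) := by
  obtain ⟨A, B, hA, hB, hwin⟩ := cutoffEnergy_le_far_add_fluxBound hrate hcont hmild hdiv
  refine ⟨A, B, hA, hB, fun T q hcl a R hR hT t₀ ht₀l ht₀ K α₁ α₂ α₃ C γ hK hγ1 hγ2 hγ3 hflux => ?_⟩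
  set s : ℝ := -R ^ 2 with hs
  have hs0 : s < t₀ := ht₀l
  -- the majorant as powers of `−t`
  set G : ℝ → ℝ := fun t => K * α₁ * R ^ (2 * γ - 1) * (-t) ^ (-γ) + K * α₂ * C * R ^ (2 * γ) * (-t) ^ (-(γ + 1 / 2)) +
    α₃ * K * Real.sqrt K * R ^ (3 * γ - 1) * (-t) ^ (-(3 * γ / 2)) with hG
  have hGflux : ∀ t ∈ Ioc s t₀,
      |∫ x, ((Δ (fun x => cutoff R (a - x))) x * ‖v t x‖ ^ 2 + fderiv ℝ (fun x => cutoff R (a - x)) x (v t x) * ‖v t x‖ ^ 2 +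
        2 * (q t x * fderiv ℝ (fun x => cutoff R (a - x)) x (v t x)))| ≤ G t := by
    intro t ht
    have ht' : t < 0 := lt_of_le_of_lt ht.2 ht₀
    rw [hG]; dsimp only
    rw [← flux_majorant_rpow hK hR ht']
    exact hflux t ht
  -- integrability and the value of `∫ G`
  have hc1 := continuousOn_neg_rpow γ hs0.le ht₀
  have hc2 := continuousOn_neg_rpow (γ + 1 / 2) hs0.le ht₀
  have hc3 := continuousOn_neg_rpow (3 * γ / 2) hs0.le ht₀
  have hi1 := (hc1.intervalIntegrable (μ := volume)).const_mul (K * α₁ * R ^ (2 * γ - 1))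
  have hi2 := (hc2.intervalIntegrable (μ := volume)).const_mul (K * α₂ * C * R ^ (2 * γ))
  have hi3 := (hc3.intervalIntegrable (μ := volume)).const_mul (α₃ * K * Real.sqrt K * R ^ (3 * γ - 1))
  have hGi : IntervalIntegrable G volume s t₀ := by
    rw [hG]; exact (hi1.add hi2).add hi3
  have hGval : ∫ t in s..t₀, G t =
      K * α₁ * R ^ (2 * γ - 1) * (((-s) ^ (1 - γ) - (-t₀) ^ (1 - γ)) / (1 - γ)) +
        K * α₂ * C * R ^ (2 * γ) * (((-s) ^ (1 - (γ + 1 / 2)) - (-t₀) ^ (1 - (γ + 1 / 2))) / (1 - (γ + 1 / 2))) +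
        α₃ * K * Real.sqrt K * R ^ (3 * γ - 1) * (((-s) ^ (1 - 3 * γ / 2) - (-t₀) ^ (1 - 3 * γ / 2)) / (1 - 3 * γ / 2)) := by
    rw [hG, intervalIntegral.integral_add (hi1.add hi2) hi3, intervalIntegral.integral_add hi1 hi2,
      intervalIntegral.integral_const_mul, intervalIntegral.integral_const_mul, intervalIntegral.integral_const_mul,
      integral_neg_rpow hγ1 hs0 ht₀, integral_neg_rpow (by intro h; apply hγ2; linarith) hs0 ht₀,
      integral_neg_rpow (by intro h; apply hγ3; linarith) hs0 ht₀]
  have hround := hwin T q hcl a R hR s t₀ hT hs0.le ht₀ G hGi hGflux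
  rw [hGval] at hround
  have hns : -s = R ^ 2 := by rw [hs, neg_neg]
  rw [hns] at hround
  exact hround

end Summit.NavierStokesRegularity.NavierStokesRegularity.Theorems.PoloidalWindowDoorPoloidalWindowRigiditySparseEnergyRound

end
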